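import Mathlib
import Summits.NavierStokesRegularity.NavierStokesRegularity.Theses.AffineBernoulli
import HarnessLib

/-!
# `AffineBernoulli.VorticityDesert` — the source lemma (item stmt-NavierStokesRegularity-13665)

**Statement.** `V, Ω ∈ C¹(ℝ³; ℝ³)`, `V(y₀) = 0`, the symmetric part of `DV(y₀)` pinched,
`a‖v‖² ≤ ⟪DV(y₀)v, v⟫ ≤ b‖v‖²` with `0 < a`, `b < 3/2`, and `DΩ·V − DV·Ω = −(3/2)Ω` everywhere.
Then `Ω` vanishes on a neighbourhood of `y₀`.

PROOF (a flow-free form of the item's docstring argument). `f = ‖Ω‖²` satisfies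
`Df(y)[V(y)] = 2⟪Ω, DΩ V⟫ = 2⟪Ω, DV Ω⟫ − 3‖Ω‖² ≤ (2b' − 3)‖Ω‖²` with `b' < 3/2` on a small closed
ball `B̄(y₀, ρ)` (continuity of `DV`), while `⟪V(y), y − y₀⟫ > 0` for `0 < ‖y − y₀‖ ≤ ρ` (`y₀`
is a source: `V(y) = DV(y₀)(y − y₀) + o(‖y − y₀‖)`). At `y₀` the equation gives
`⟪DV(y₀)Ω, Ω⟫ = (3/2)‖Ω‖²`, so `Ω(y₀) = 0`. Take a maximum point `y*` of `f` on the compact ball; if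
`f(y*) > 0` then `y* ≠ y₀`, the segment from `y*` in the direction `−V(y*)` enters the ball (it
decreases `‖· − y₀‖`), so the one-sided derivative of `f` at the constrained maximum gives
`Df(y*)[−V(y*)] ≤ 0` (`IsLocalMaxOn.hasFDerivWithinAt_nonpos`), contradicting
`Df(y*)[V(y*)] ≤ (2b' − 3) f(y*) < 0`. Hence `f = 0` on the ball.

HONEST FRAMING: an elementary lemma about HYPOTHETICAL stationary profile data; nothing here bears
on the regularity problem itself.
-/

noncomputable section

set_option linter.dupNamespace false

namespace Summit.NavierStokesRegularity.NavierStokesRegularity.Theorems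

open Set Filter Topology Metric Function
open scoped RealInnerProductSpace

/-- **Item stmt-NavierStokesRegularity-13665** (`AffineBernoulli.VorticityDesert`): the source
lemma — near a nondegenerate source of `V` with `b < 3/2`, a field `Ω` with
`DΩ·V − DV·Ω = −(3/2)Ω` vanishes identically (maximum of `‖Ω‖²` on a small ball + one-sided
derivative along `−V`). [cite: ConstantinIgnatovaVicol2026Putative, Prop. 3.9 (the `γ < 1/2` analogue at outgoing points)] -/
theorem affineBernoulli_vorticityDesert_proof :
    Summit.NavierStokesRegularity.NavierStokesRegularity.Theses.AffineBernoulli.VorticityDesert := by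
  unfold Summit.NavierStokesRegularity.NavierStokesRegularity.Theses.AffineBernoulli.VorticityDesert
  intro V Ω y₀ hV hΩ hV0 hpinch heq
  obtain ⟨a, b, ha, hb, hab⟩ := hpinch
  set A : EuclideanSpace ℝ (Fin 3) →L[ℝ] EuclideanSpace ℝ (Fin 3) := fderiv ℝ V y₀ with hA
  have hVd : Differentiable ℝ V := hV.differentiable one_ne_zero
  have hΩd : Differentiable ℝ Ω := hΩ.differentiable one_ne_zero
  -- `Ω(y₀) = 0`
  have hΩ0 : Ω y₀ = 0 := by
    have h := heq y₀
    rw [hV0, map_zero, zero_sub, neg_inj] at h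
    -- `⟪DV(y₀) Ω, Ω⟫ = (3/2)‖Ω‖² ≤ b‖Ω‖²`
    have h1 := (hab (Ω y₀)).2
    rw [h, inner_smul_left, real_inner_self_eq_norm_sq] at h1
    simp only [map_div₀, map_ofNat] at h1
    have : ‖Ω y₀‖ ^ 2 = 0 := by nlinarith [sq_nonneg ‖Ω y₀‖]
    exact norm_eq_zero.1 (pow_eq_zero_iff two_ne_zero |>.1 this)
  -- a radius where `DV` is close to `A` and `y₀` repels
  set δ₁ : ℝ := (3 / 2 - b) / 2 with hδ₁
  have hδ₁pos : 0 < δ₁ := by rw [hδ₁]; linarith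
  have hcontD : Continuous (fderiv ℝ V) := hV.continuous_fderiv one_ne_zero
  have hev1 : ∀ᶠ y in 𝓝 y₀, ‖fderiv ℝ V y - A‖ < δ₁ := by
    have := (hcontD.tendsto y₀).eventually (Metric.ball_mem_nhds (fderiv ℝ V y₀) hδ₁pos)
    exact this.mono fun y hy => by
      have hy' : dist (fderiv ℝ V y) (fderiv ℝ V y₀) < δ₁ := hy
      rwa [dist_eq_norm] at hy'
  have hev2 : ∀ᶠ y in 𝓝 y₀, ‖V y - V y₀ - A (y - y₀)‖ ≤ a / 2 * ‖y - y₀‖ :=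
    (hVd y₀).hasFDerivAt.isLittleO.bound (half_pos ha)
  obtain ⟨ρ₀, hρ₀, hρ₀sub⟩ := Metric.eventually_nhds_iff_ball.1 (hev1.and hev2)
  set ρ : ℝ := ρ₀ / 2 with hρ
  have hρpos : 0 < ρ := by positivity
  have hball : closedBall y₀ ρ ⊆ ball y₀ ρ₀ :=
    closedBall_subset_ball (by rw [hρ]; linarith)
  -- (i) the stretching bound on the ball: `⟪DV(y) w, w⟫ ≤ (b + δ₁)‖w‖²`
  have hstretch : ∀ y ∈ closedBall y₀ ρ, ∀ w : EuclideanSpace ℝ (Fin 3),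
      ⟪fderiv ℝ V y w, w⟫ ≤ (b + δ₁) * ‖w‖ ^ 2 := by
    intro y hy w
    have h1 : ‖fderiv ℝ V y - A‖ < δ₁ := (hρ₀sub y (hball hy)).1
    have h2 : ⟪(fderiv ℝ V y - A) w, w⟫ ≤ δ₁ * ‖w‖ ^ 2 := by
      calc ⟪(fderiv ℝ V y - A) w, w⟫ ≤ ‖(fderiv ℝ V y - A) w‖ * ‖w‖ := real_inner_le_norm _ _
        _ ≤ ‖fderiv ℝ V y - A‖ * ‖w‖ * ‖w‖ := by
            gcongr; exact ContinuousLinearMap.le_opNorm _ _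
        _ ≤ δ₁ * ‖w‖ * ‖w‖ := by gcongr
        _ = δ₁ * ‖w‖ ^ 2 := by ring
    have h3 : ⟪fderiv ℝ V y w, w⟫ = ⟪A w, w⟫ + ⟪(fderiv ℝ V y - A) w, w⟫ := by
      rw [show (fderiv ℝ V y - A) w = fderiv ℝ V y w - A w from rfl, inner_sub_left]; ring
    rw [h3]
    linarith [(hab w).2]
  -- (ii) the source inequality: `⟪V y, y - y₀⟫ ≥ (a/2)‖y - y₀‖²`
  have hsource : ∀ y ∈ closedBall y₀ ρ, a / 2 * ‖y - y₀‖ ^ 2 ≤ ⟪V y, y - y₀⟫ := by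
    intro y hy
    have h2 : ‖V y - V y₀ - A (y - y₀)‖ ≤ a / 2 * ‖y - y₀‖ := (hρ₀sub y (hball hy)).2
    rw [hV0, sub_zero] at h2
    have h3 : ⟪V y, y - y₀⟫ = ⟪A (y - y₀), y - y₀⟫ + ⟪V y - A (y - y₀), y - y₀⟫ := by
      rw [← inner_add_left, add_sub_cancel]
    have h4 : |⟪V y - A (y - y₀), y - y₀⟫| ≤ a / 2 * ‖y - y₀‖ * ‖y - y₀‖ :=
      (abs_real_inner_le_norm _ _).trans (mul_le_mul_of_nonneg_right h2 (norm_nonneg _))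
    have h5 := (hab (y - y₀)).1
    rw [h3]
    have h6 := neg_le_of_abs_le h4
    nlinarith
  -- the derivative of `f = ‖Ω‖²` along `V`
  set f : EuclideanSpace ℝ (Fin 3) → ℝ := fun y => ‖Ω y‖ ^ 2 with hf
  have hfD : ∀ y, HasFDerivAt f (2 • (innerSL ℝ (Ω y)).comp (fderiv ℝ Ω y)) y :=
    fun y => (hΩd y).hasFDerivAt.norm_sq
  have hLapply : ∀ y w, (2 • (innerSL ℝ (Ω y)).comp (fderiv ℝ Ω y)) w =
      2 * ⟪Ω y, fderiv ℝ Ω y w⟫ := by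
    intro y w
    rw [show (2 • (innerSL ℝ (Ω y)).comp (fderiv ℝ Ω y)) w =
        2 • ((innerSL ℝ (Ω y)).comp (fderiv ℝ Ω y) w) from rfl, ContinuousLinearMap.comp_apply,
      innerSL_apply_apply, nsmul_eq_mul, Nat.cast_ofNat]
  have hfV : ∀ y ∈ closedBall y₀ ρ,
      (2 • (innerSL ℝ (Ω y)).comp (fderiv ℝ Ω y)) (V y) ≤ -(3 / 2 - b) * ‖Ω y‖ ^ 2 := by
    intro y hy
    have h1 : fderiv ℝ Ω y (V y) = fderiv ℝ V y (Ω y) - (3 / 2 : ℝ) • Ω y := by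
      have := heq y
      rw [sub_eq_iff_eq_add] at this
      rw [this]; abel
    rw [hLapply, h1, inner_sub_right, inner_smul_right, real_inner_self_eq_norm_sq,
      real_inner_comm]
    have h2 := hstretch y hy (Ω y)
    rw [hδ₁] at h2
    nlinarith [sq_nonneg ‖Ω y‖]
  -- a maximum point of `f` on the closed ball
  have hfc : Continuous f := (hΩ.continuous.norm).pow 2
  obtain ⟨ys, hys, hmax⟩ := (isCompact_closedBall y₀ ρ).exists_isMaxOn
    ⟨y₀, mem_closedBall_self hρpos.le⟩ hfc.continuousOn
  -- the maximum vanishes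
  have hmax0 : f ys ≤ 0 := by
    by_contra hpos
    push Not at hpos
    have hne : ys ≠ y₀ := by
      rintro rfl
      simp [hf, hΩ0] at hpos
    have hys0 : 0 < ‖ys - y₀‖ := norm_pos_iff.2 (sub_ne_zero.2 hne)
    have hsrc : 0 < ⟪V ys, ys - y₀⟫ := lt_of_lt_of_le (by positivity) (hsource ys hys)
    have hVne : V ys ≠ 0 := by
      intro h; rw [h, inner_zero_left] at hsrc; exact lt_irrefl _ hsrc
    have hVpos : 0 < ‖V ys‖ ^ 2 := by positivity
    -- the segment from `ys` along `-V ys` of length `τ₀` stays in the ball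
    set τ₀ : ℝ := 2 * ⟪V ys, ys - y₀⟫ / ‖V ys‖ ^ 2 with hτ₀
    have hτ₀pos : 0 < τ₀ := by positivity
    set d : EuclideanSpace ℝ (Fin 3) := τ₀ • (-V ys) with hd
    have hseg : segment ℝ ys (ys + d) ⊆ closedBall y₀ ρ := by
      rw [segment_eq_image']
      rintro _ ⟨θ, hθ, rfl⟩
      rw [mem_closedBall, dist_eq_norm]
      have hysρ : ‖ys - y₀‖ ≤ ρ := mem_closedBall_iff_norm.1 hys
      -- `‖ys + θ d - y₀‖² ≤ ‖ys - y₀‖²`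
      have hsq : ‖ys + θ • (ys + d - ys) - y₀‖ ^ 2 ≤ ‖ys - y₀‖ ^ 2 := by
        have e : ys + θ • (ys + d - ys) - y₀ = (ys - y₀) - (θ * τ₀) • V ys := by
          rw [add_sub_cancel_left, hd, smul_neg, smul_neg, smul_smul]; abel
        rw [e, norm_sub_sq_real, inner_smul_right, norm_smul, Real.norm_eq_abs,
          abs_of_nonneg (by nlinarith [hθ.1] : 0 ≤ θ * τ₀), mul_pow, real_inner_comm]
        -- `(θτ₀)²‖V‖² ≤ 2 θτ₀ ⟪V, ys - y₀⟫` since `θτ₀ ≤ τ₀ = 2⟪V, ys-y₀⟫/‖V‖²`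
        have hθτ : θ * τ₀ ≤ τ₀ := by nlinarith [hθ.2]
        have hkey : (θ * τ₀) * ‖V ys‖ ^ 2 ≤ 2 * ⟪V ys, ys - y₀⟫ := by
          calc (θ * τ₀) * ‖V ys‖ ^ 2 ≤ τ₀ * ‖V ys‖ ^ 2 :=
                mul_le_mul_of_nonneg_right hθτ hVpos.le
            _ = 2 * ⟪V ys, ys - y₀⟫ := by rw [hτ₀]; field_simp
        nlinarith [mul_nonneg (mul_nonneg hθ.1 hτ₀pos.le) (sub_nonneg.2 hkey)]
      have h1 : ‖ys + θ • (ys + d - ys) - y₀‖ ≤ ‖ys - y₀‖ :=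
        (pow_le_pow_iff_left₀ (norm_nonneg _) (norm_nonneg _) two_ne_zero).1 hsq
      exact h1.trans hysρ
    have hcone : d ∈ posTangentConeAt (closedBall y₀ ρ) ys :=
      mem_posTangentConeAt_of_segment_subset hseg
    have hlocmax : IsLocalMaxOn f (closedBall y₀ ρ) ys := hmax.localize
    have hderiv := hlocmax.hasFDerivWithinAt_nonpos (hfD ys).hasFDerivWithinAt hcone
    have hLV := hfV ys hys
    have hd' : (2 • (innerSL ℝ (Ω ys)).comp (fderiv ℝ Ω ys)) d =
        -(τ₀ * (2 • (innerSL ℝ (Ω ys)).comp (fderiv ℝ Ω ys)) (V ys)) := by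
      rw [hd, map_smul, map_neg, smul_eq_mul, mul_neg]
    rw [hd'] at hderiv
    have hfys : 0 < ‖Ω ys‖ ^ 2 := hpos
    have hb' : 0 < 3 / 2 - b := by linarith
    nlinarith [mul_pos hτ₀pos (mul_pos hb' hfys)]
  -- conclusion
  refine ⟨ρ, hρpos, fun y hy => ?_⟩
  have hfy : f y ≤ 0 := (hmax (mem_closedBall.2 (le_of_lt hy))).trans hmax0
  have : ‖Ω y‖ ^ 2 = 0 := le_antisymm hfy (sq_nonneg _)
  exact norm_eq_zero.1 (pow_eq_zero_iff two_ne_zero |>.1 this)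

end Summit.NavierStokesRegularity.NavierStokesRegularity.Theorems

end
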